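import Literature.ModelTheory.ExponentialFields.RealExpTransfer
import Mathlib.Analysis.Calculus.LagrangeMultipliers
import Mathlib.Analysis.Normed.Group.Bounded
import Mathlib.Analysis.Normed.Module.FiniteDimension
import Mathlib.Topology.Order.Compact
import HarnessLib

/-!
# Two results of calculus in the models of `T_exp`, by transfer (Wilkie 1989, §2 and p. 397)

Trunk `TranscendEllArithS`, family `periods` (periods.S28), in support of the decomposition of
the named fact `Literature.ModelTheory.ExponentialFields.wilkie_isModelComplete` along A. J. Wilkie, *On the theory of the real
exponential field*, Illinois J. Math. 33 (1989).  Wilkie works in an arbitrary model `K` of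
`T = Th(ℝ_exp)` and imports results of calculus "by transfer" (§2, p. 387).  Two such results
are used in the proof of his Lemma 3 (pp. 396–398); both are **proved** here, in every model `K`
of `T_exp`, from their real counterparts in Mathlib and the transfer of formulas
(`RealExpTransfer.lean`):

* `Literature.ModelTheory.ExponentialFields.RealExpModel.not_linearIndependent_gradRows_of_isLocalMin` (**Lagrange multipliers in `K`**,
  the use of §2 on p. 397: "the function `D` … has a local minimum there. Thus (by Section 2)
  `(ω ∧ dD)(γ) = 0`, where `ω = dh₁ ∧ ⋯ ∧ dhₚ`"): if exponential terms `h₁, …, hₚ` (parameters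
  from `K`) vanish at `γ ∈ Kⁿ` and a term `g` restricted to the zero set `V(h₁, …, hₚ)` has a
  local minimum at `γ` (local for the balls `Σ (xⱼ - γⱼ)² < ε`, `ε ∈ K`, `ε > 0`, of p. 388), then
  the gradients `∇h₁(γ), …, ∇hₚ(γ), ∇g(γ)` (rows of formal partial derivatives, Wilkie's
  `∂/∂xᵢ` of p. 385) are linearly dependent over `K`; equivalently all `(p+1) × (p+1)` minors of
  this Jacobian vanish, i.e. `(dh₁ ∧ ⋯ ∧ dhₚ ∧ dg)(γ) = 0` (p. 386).  Real counterpart: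
  Mathlib's `IsLocalExtrOn.exists_multipliers_of_hasStrictFDerivAt`.
* `Literature.ModelTheory.ExponentialFields.RealExpModel.exists_isMinOn_sqDist` (**points at minimal distance**, p. 397: "(by transfer)
  let `(γ, γₙ₊₁)` be a point of (the "closed" set) `V(h₁, …, hₚ₊₁, F)` at minimal distance from
  `(η, 0)`"): a nonempty zero set `V(h₁, …, h_q) ⊆ Kᵐ` of exponential terms contains a point
  minimizing `Σⱼ (xⱼ - cⱼ)²` over `V`, for any parameter point `c`.  Real counterpart: the extreme
  value theorem on a closed set for a coercive function (`ContinuousOn.exists_isMinOn'`).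

Both are obtained by writing the statement, uniformly in the parameters, as a first-order
formula (`lagrangeFormula`, `argminFormula`), computing its realization in any lawful structure,
proving it in `ℝ`, and transferring (`RealExpModel.realize_formula_of_real`).

## References

* A. J. Wilkie, *On the theory of the real exponential field*, Illinois J. Math. 33 (1989),
  384–408: §2 (pp. 387–390), proof of Lemma 3 (p. 397).
-/

noncomputable section

open FirstOrder FirstOrder.Language FirstOrder.Language.Structure
open Filter Topology

namespace Literature.ModelTheory.ExponentialFields

namespace RealExpModel

/-! ### Gradients of terms -/

section Grad

variable {M : Type*} [Language.orderedExpRing.Structure M] {κ : Type} {n : ℕ}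

/-- The **gradient row** `(∂t/∂x₁, …, ∂t/∂xₙ)(a; γ)` of a term `t` at a point `γ`: the
realizations of Wilkie's formal partial derivatives (Wilkie 1989, p. 385; the rows of the
Jacobian matrices of p. 386). [cite: Wilkie1989, §1, p. 385] -/
def grad (t : Language.orderedExpRing.Term (κ ⊕ Fin n)) (a : κ → M) (γ : Fin n → M) : Fin n → M :=
  fun j => (termPDeriv j t).realize (Sum.elim a γ)

/-- Entries of the gradient row. [folklore] -/
theorem grad_apply (t : Language.orderedExpRing.Term (κ ⊕ Fin n)) (a : κ → M)
    (γ : Fin n → M) (j : Fin n) : grad t a γ j = (termPDeriv j t).realize (Sum.elim a γ) := rfl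

/-- The rows `∇g(γ), ∇h₁(γ), …, ∇hₚ(γ)` of the Jacobian of the system `(h₁, …, hₚ, g)`, indexed by
`Option (Fin p)` (`none` for `g`). [folklore] -/
def gradRows {p : ℕ} (h : Fin p → Language.orderedExpRing.Term (κ ⊕ Fin n))
    (g : Language.orderedExpRing.Term (κ ⊕ Fin n)) (a : κ → M) (γ : Fin n → M) :
    Option (Fin p) → Fin n → M :=
  fun i => i.elim (grad g a γ) fun r => grad (h r) a γ

/-- The row of `g`. [folklore] -/
@[simp] theorem gradRows_none {p : ℕ} (h : Fin p → Language.orderedExpRing.Term (κ ⊕ Fin n))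
    (g : Language.orderedExpRing.Term (κ ⊕ Fin n)) (a : κ → M) (γ : Fin n → M) :
    gradRows h g a γ none = grad g a γ := rfl

/-- The rows of the `hᵣ`. [folklore] -/
@[simp] theorem gradRows_some {p : ℕ} (h : Fin p → Language.orderedExpRing.Term (κ ⊕ Fin n))
    (g : Language.orderedExpRing.Term (κ ⊕ Fin n)) (a : κ → M) (γ : Fin n → M) (r : Fin p) :
    gradRows h g a γ (some r) = grad (h r) a γ := rfl

end Grad

/-! ### Lagrange multipliers, by transfer -/

section Lagrange

variable {κ : Type} {n p : ℕ}

/-- The terms `∂hᵣ/∂xⱼ` (`i = some r`) and `∂g/∂xⱼ` (`i = none`). [folklore] -/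
def pderivRows (h : Fin p → Language.orderedExpRing.Term (κ ⊕ Fin n))
    (g : Language.orderedExpRing.Term (κ ⊕ Fin n)) (i : Option (Fin p)) (j : Fin n) :
    Language.orderedExpRing.Term (κ ⊕ Fin n) :=
  i.elim (termPDeriv j g) fun r => termPDeriv j (h r)

/-- The first-order formula expressing the Lagrange multiplier theorem for the system `h₁, …, hₚ`
and the objective `g`, in the free variables: parameters `κ`, the point `γ` (`Fin n`) and the
radius `ε` (`Fin 1`).  It reads: if `0 < ε`, `h₁(γ) = ⋯ = hₚ(γ) = 0` and
`∀ x, (Σⱼ (xⱼ - γⱼ)² < ε ∧ h₁(x) = ⋯ = hₚ(x) = 0) → g(γ) ≤ g(x)`, then there are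
`λ₀, λ₁, …, λₚ`, not all zero, with `Σᵣ λᵣ ∂hᵣ/∂xⱼ(γ) + λ₀ ∂g/∂xⱼ(γ) = 0` for every `j`. [folklore] -/
def lagrangeFormula (h : Fin p → Language.orderedExpRing.Term (κ ⊕ Fin n))
    (g : Language.orderedExpRing.Term (κ ⊕ Fin n)) :
    Language.orderedExpRing.Formula ((κ ⊕ Fin n) ⊕ Fin 1) :=
  let W := (κ ⊕ Fin n) ⊕ Fin 1
  -- `t(γ)` as a term in the variables `W`, and in `W ⊕ β`
  let atγ : Language.orderedExpRing.Term (κ ⊕ Fin n) → Language.orderedExpRing.Term W :=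
    fun t => t.relabel Sum.inl
  -- `t(x)` for the universally quantified point `x : Fin n`
  let atx : Language.orderedExpRing.Term (κ ⊕ Fin n) → Language.orderedExpRing.Term (W ⊕ Fin n) :=
    fun t => t.relabel (Sum.map (Sum.inl ∘ Sum.inl) _root_.id)
  let hyp₁ : Language.orderedExpRing.Formula W := ExpFormula.lt 0 (var (Sum.inr 0))
  let hyp₂ : Language.orderedExpRing.Formula W := Formula.iInf fun r => ExpFormula.eq (atγ (h r)) 0
  let ball : Language.orderedExpRing.Formula (W ⊕ Fin n) :=
    ExpFormula.lt
      (ExpTerm.sum fun j : Fin n =>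
        (var (Sum.inr j) + -var (Sum.inl (Sum.inl (Sum.inr j)))) *
          (var (Sum.inr j) + -var (Sum.inl (Sum.inl (Sum.inr j)))))
      (var (Sum.inl (Sum.inr 0)))
  let hyp₃ : Language.orderedExpRing.Formula W :=
    Formula.iAlls (Fin n)
      ((ball ⊓ Formula.iInf fun r => ExpFormula.eq (atx (h r)) 0) ⟹
        ExpFormula.le ((atγ g).relabel Sum.inl) (atx g))
  let concl : Language.orderedExpRing.Formula W :=
    Formula.iExs (Option (Fin p))
      ((Formula.iInf fun i : Option (Fin p) =>
          ExpFormula.eq (var (Sum.inr i)) (0 : Language.orderedExpRing.Term (W ⊕ Option (Fin p)))).not ⊓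
        Formula.iInf fun j : Fin n =>
          ExpFormula.eq
            (ExpTerm.sum fun i : Fin (p + 1) =>
              var (Sum.inr (finSuccEquiv p i)) *
                ((atγ (pderivRows h g (finSuccEquiv p i) j)).relabel Sum.inl))
            0)
  (hyp₁ ⊓ hyp₂ ⊓ hyp₃) ⟹ concl

/-- Realization of `lagrangeFormula` in a lawful structure. [folklore] -/
theorem realize_lagrangeFormula {M : Type*} [Language.orderedExpRing.Structure M] [Field M]
    [LinearOrder M] [LawfulStructure M]
    (h : Fin p → Language.orderedExpRing.Term (κ ⊕ Fin n))
    (g : Language.orderedExpRing.Term (κ ⊕ Fin n)) (v : (κ ⊕ Fin n) ⊕ Fin 1 → M) :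
    (lagrangeFormula h g).Realize v ↔
      ((0 < v (Sum.inr 0) ∧
        (∀ r, (h r).realize (v ∘ Sum.inl) = 0) ∧
        ∀ x : Fin n → M,
          (∑ j, (x j + -v (Sum.inl (Sum.inr j))) * (x j + -v (Sum.inl (Sum.inr j))) < v (Sum.inr 0) ∧
            ∀ r, (h r).realize (Sum.elim (fun c => v (Sum.inl (Sum.inl c))) x) = 0) →
          g.realize (v ∘ Sum.inl) ≤ g.realize (Sum.elim (fun c => v (Sum.inl (Sum.inl c))) x)) →
      ∃ l : Option (Fin p) → M, (¬ ∀ i, l i = 0) ∧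
        ∀ j : Fin n, ∑ i, l i * (pderivRows h g i j).realize (v ∘ Sum.inl) = 0) := by
  have e1 : ∀ (x : Fin n → M),
      ((fun a => Sum.elim v x a) ∘ Sum.map (Sum.inl ∘ Sum.inl) _root_.id :
          κ ⊕ Fin n → M) = Sum.elim (fun c => v (Sum.inl (Sum.inl c))) x := by
    intro x
    funext a
    rcases a with a | a <;> rfl
  have e3 : ∀ l : Option (Fin p) → M, ∀ j : Fin n,
      (∑ i : Fin (p + 1), l (finSuccEquiv p i) *
          (pderivRows h g (finSuccEquiv p i) j).realize (v ∘ Sum.inl)) =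
        ∑ i, l i * (pderivRows h g i j).realize (v ∘ Sum.inl) := by
    intro l j
    exact Equiv.sum_comp (finSuccEquiv p)
      (fun i => l i * (pderivRows h g i j).realize (v ∘ Sum.inl))
  simp only [lagrangeFormula, Formula.realize_imp, Formula.realize_inf, Formula.realize_iInf,
    Formula.realize_iAlls, Formula.realize_iExs, Formula.realize_not, ExpFormula.realize_lt,
    ExpFormula.realize_le, ExpFormula.realize_eq, ExpTerm.realize_zero, ExpTerm.realize_sum,
    ExpTerm.realize_mul, ExpTerm.realize_add, ExpTerm.realize_neg, Term.realize_var,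
    Term.realize_relabel, Sum.elim_comp_inl, Sum.elim_inr, Sum.elim_inl, e1, e3, and_assoc]

/-- **The Lagrange multiplier theorem for exponential terms holds in `ℝ`**, in the first-order form
`lagrangeFormula` (from Mathlib's `IsLocalExtrOn.exists_multipliers_of_hasStrictFDerivAt`, the
smoothness of exponential terms and `fderiv_realize_single`). [folklore] -/
theorem realize_lagrangeFormula_real (h : Fin p → Language.orderedExpRing.Term (κ ⊕ Fin n))
    (g : Language.orderedExpRing.Term (κ ⊕ Fin n)) (v : (κ ⊕ Fin n) ⊕ Fin 1 → ℝ) :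
    (lagrangeFormula h g).Realize v := by
  rw [realize_lagrangeFormula]
  rintro ⟨hε, hγ, hmin⟩
  set a : κ → ℝ := fun c => v (Sum.inl (Sum.inl c)) with ha
  set γ : Fin n → ℝ := fun j => v (Sum.inl (Sum.inr j)) with hγdef
  have hva : v ∘ Sum.inl = Sum.elim a γ := by
    funext x; rcases x with c | j <;> rfl
  rw [hva] at hγ hmin ⊢
  -- the functions
  set H : Fin p → (Fin n → ℝ) → ℝ := fun r x => (h r).realize (Sum.elim a x) with hH
  set G : (Fin n → ℝ) → ℝ := fun x => g.realize (Sum.elim a x) with hG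
  -- local minimum of `G` on the zero set of the `H r`
  have hextr : IsLocalExtrOn G {x | ∀ r, H r x = H r γ} γ := by
    have hset : {x : Fin n → ℝ | ∀ r, H r x = H r γ} = {x | ∀ r, H r x = 0} := by
      ext x
      simp only [Set.mem_setOf_eq]
      exact forall_congr' fun r => by rw [show H r γ = 0 from hγ r]
    rw [hset]
    refine IsMinFilter.isExtr ?_
    show ∀ᶠ x in 𝓝[{x | ∀ r, H r x = 0}] γ, G γ ≤ G x
    rw [eventually_nhdsWithin_iff]
    have hopen : IsOpen {x : Fin n → ℝ | ∑ j, (x j + -γ j) * (x j + -γ j) < v (Sum.inr 0)} :=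
      isOpen_lt (by fun_prop) continuous_const
    have hmem : γ ∈ {x : Fin n → ℝ | ∑ j, (x j + -γ j) * (x j + -γ j) < v (Sum.inr 0)} := by
      simpa using hε
    filter_upwards [hopen.mem_nhds hmem] with x hx hxV
    exact hmin x ⟨hx, hxV⟩
  have hH' : ∀ r, HasStrictFDerivAt (H r) (fderiv ℝ (H r) γ) γ := fun r =>
    hasStrictFDerivAt_realize (h r) a γ
  have hG' : HasStrictFDerivAt G (fderiv ℝ G γ) γ := hasStrictFDerivAt_realize g a γ
  obtain ⟨Λ, Λ₀, hne, hsum⟩ := hextr.exists_multipliers_of_hasStrictFDerivAt hH' hG'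
  refine ⟨fun i => i.elim Λ₀ Λ, ?_, fun j => ?_⟩
  · intro h0
    apply hne
    ext r
    · exact h0 (some r)
    · exact h0 none
  · have := DFunLike.congr_fun hsum (Pi.single j 1)
    simp at this
    rw [Fintype.sum_option]
    simp only [pderivRows, Option.elim_none, Option.elim_some]
    rw [← fderiv_realize_single g a γ j]
    simp_rw [← fderiv_realize_single (h _) a γ j]
    linarith [this]

/-- **Lagrange multipliers in the models of `T_exp`, by transfer** (Wilkie 1989, §2, used on p. 397:
"`D` … has a local minimum there. Thus (by Section 2) `(ω ∧ dD)(γ) = 0`, where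
`ω = dh₁ ∧ ⋯ ∧ dhₚ`").  Let `K ⊨ T_exp`, let `h₁, …, hₚ, g` be exponential terms with parameters
`a` from `K`, and let `γ ∈ Kⁿ` be a common zero of the `hᵣ` at which `g`, restricted to the zero
set `V(h₁, …, hₚ)`, has a local minimum (with respect to the balls `Σⱼ (xⱼ - γⱼ)² < ε`, `0 < ε ∈ K`,
of p. 388).  Then the gradient rows `∇g(γ), ∇h₁(γ), …, ∇hₚ(γ)` are linearly dependent over `K`
(equivalently, all maximal minors of the Jacobian of `(h₁, …, hₚ, g)` at `γ` vanish:
`(dh₁ ∧ ⋯ ∧ dhₚ ∧ dg)(γ) = 0`).  Proved from the real Lagrange multiplier theorem by transfer.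
[cite: Wilkie1989, §2, pp. 387–390 and p. 397] -/
theorem not_linearIndependent_gradRows_of_isLocalMin
    (K : Language.Theory.ModelType.{0, 0, 0} realExpTheory) (a : κ → K)
    (h : Fin p → Language.orderedExpRing.Term (κ ⊕ Fin n))
    (g : Language.orderedExpRing.Term (κ ⊕ Fin n)) (γ : Fin n → K)
    (hγ : ∀ r, (h r).realize (Sum.elim a γ) = 0) {ε : K} (hε : 0 < ε)
    (hmin : ∀ x : Fin n → K, ∑ j, (x j - γ j) ^ 2 < ε →
      (∀ r, (h r).realize (Sum.elim a x) = 0) → g.realize (Sum.elim a γ) ≤ g.realize (Sum.elim a x)) :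
    ¬ LinearIndependent K (gradRows h g a γ) := by
  have H := realize_formula_of_real K (lagrangeFormula h g) (realize_lagrangeFormula_real h g)
    (Sum.elim (Sum.elim a γ) fun _ => ε)
  rw [realize_lagrangeFormula] at H
  simp only [Sum.elim_comp_inl, Sum.elim_inr, Sum.elim_inl] at H
  obtain ⟨l, hl0, hl⟩ := H ⟨hε, hγ, fun x hx => hmin x (by
    simpa [sq, sub_eq_add_neg] using hx.1) hx.2⟩
  rw [Fintype.not_linearIndependent_iff]
  refine ⟨l, ?_, by simpa using hl0⟩
  funext j
  simp only [Finset.sum_apply, Pi.smul_apply, smul_eq_mul, Pi.zero_apply]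
  convert hl j using 2 with i
  rcases i with _ | r <;> rfl

end Lagrange

/-! ### Points at minimal distance, by transfer -/

section Argmin

variable {κ : Type} {m q : ℕ}

/-- The squared distance `Σⱼ (xⱼ - cⱼ)²` to a point with coordinates the parameter terms `cⱼ`,
as a term. [folklore] -/
def sqDist (c : Fin m → Language.orderedExpRing.Term κ) :
    Language.orderedExpRing.Term (κ ⊕ Fin m) :=
  ExpTerm.sum fun j => (var (Sum.inr j) + -(c j).relabel Sum.inl) *
    (var (Sum.inr j) + -(c j).relabel Sum.inl)

/-- Realization of the squared distance term. [folklore] -/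
@[simp] theorem realize_sqDist {M : Type*} [Language.orderedExpRing.Structure M] [Field M]
    [LinearOrder M] [LawfulStructure M] (c : Fin m → Language.orderedExpRing.Term κ) (a : κ → M)
    (x : Fin m → M) :
    (sqDist c).realize (Sum.elim a x) = ∑ j, (x j - (c j).realize a) ^ 2 := by
  simp [sqDist, Term.realize_relabel, sq, sub_eq_add_neg]

/-- The first-order formula (free variables: the parameters `κ`) expressing that if the zero set
`V(h₁, …, h_q) ⊆ Mᵐ` is nonempty then it contains a point minimizing `Σⱼ (xⱼ - cⱼ)²` over `V`.
[folklore] -/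
def argminFormula (h : Fin q → Language.orderedExpRing.Term (κ ⊕ Fin m))
    (c : Fin m → Language.orderedExpRing.Term κ) : Language.orderedExpRing.Formula κ :=
  let inV : Language.orderedExpRing.Formula (κ ⊕ Fin m) :=
    Formula.iInf fun r => ExpFormula.eq (h r) 0
  let inV' : Language.orderedExpRing.Formula ((κ ⊕ Fin m) ⊕ Fin m) :=
    Formula.iInf fun r => ExpFormula.eq ((h r).relabel (Sum.map Sum.inl _root_.id)) 0
  Formula.iExs (Fin m) inV ⟹
    Formula.iExs (Fin m)
      (inV ⊓ Formula.iAlls (Fin m)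
        (inV' ⟹ ExpFormula.le ((sqDist c).relabel Sum.inl)
          ((sqDist c).relabel (Sum.map Sum.inl _root_.id))))

/-- Realization of `argminFormula` in a lawful structure. [folklore] -/
theorem realize_argminFormula {M : Type*} [Language.orderedExpRing.Structure M] [Field M]
    [LinearOrder M] [LawfulStructure M]
    (h : Fin q → Language.orderedExpRing.Term (κ ⊕ Fin m))
    (c : Fin m → Language.orderedExpRing.Term κ) (a : κ → M) :
    (argminFormula h c).Realize a ↔
      ((∃ x : Fin m → M, ∀ r, (h r).realize (Sum.elim a x) = 0) →
        ∃ v : Fin m → M, (∀ r, (h r).realize (Sum.elim a v) = 0) ∧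
          ∀ w : Fin m → M, (∀ r, (h r).realize (Sum.elim a w) = 0) →
            ∑ j, (v j - (c j).realize a) ^ 2 ≤ ∑ j, (w j - (c j).realize a) ^ 2) := by
  have e1 : ∀ (x w : Fin m → M) (t : Language.orderedExpRing.Term (κ ⊕ Fin m)),
      (t.relabel (Sum.map Sum.inl _root_.id)).realize (Sum.elim (Sum.elim a x) w) =
        t.realize (Sum.elim a w) := by
    intro x w t
    rw [Term.realize_relabel]
    congr 1
    funext y
    rcases y with y | y <;> rfl
  have e2 : ∀ (x w : Fin m → M) (t : Language.orderedExpRing.Term (κ ⊕ Fin m)),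
      (t.relabel Sum.inl).realize (Sum.elim (Sum.elim a x) w) = t.realize (Sum.elim a x) := by
    intro x w t
    rw [Term.realize_relabel, Sum.elim_comp_inl]
  simp only [argminFormula, Formula.realize_imp, Formula.realize_inf, Formula.realize_iInf,
    Formula.realize_iAlls, Formula.realize_iExs, ExpFormula.realize_le, ExpFormula.realize_eq,
    ExpTerm.realize_zero]
  refine imp_congr Iff.rfl (exists_congr fun x => and_congr Iff.rfl (forall_congr' fun w => ?_))
  rw [e2, e1, realize_sqDist, realize_sqDist]
  exact imp_congr (forall_congr' fun r => by rw [e1]) Iff.rfl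

/-- **Existence of points at minimal distance holds in `ℝ`**, in the first-order form
`argminFormula`: the zero set of finitely many exponential terms is closed and the squared
distance to a point is continuous and coercive (`ContinuousOn.exists_isMinOn'`). [folklore] -/
theorem realize_argminFormula_real (h : Fin q → Language.orderedExpRing.Term (κ ⊕ Fin m))
    (c : Fin m → Language.orderedExpRing.Term κ) (a : κ → ℝ) : (argminFormula h c).Realize a := by
  rw [realize_argminFormula]
  rintro ⟨x₀, hx₀⟩
  set V : Set (Fin m → ℝ) := {x | ∀ r, (h r).realize (Sum.elim a x) = 0} with hV
  set c' : Fin m → ℝ := fun j => (c j).realize a with hc'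
  set D : (Fin m → ℝ) → ℝ := fun x => ∑ j, (x j - c' j) ^ 2 with hD
  have hVc : IsClosed V := by
    have : V = ⋂ r, {x | (h r).realize (Sum.elim a x) = 0} := by
      ext x; simp [hV]
    rw [this]
    exact isClosed_iInter fun r => isClosed_eq (continuous_realize (h r) a) continuous_const
  have hDc : Continuous D := by fun_prop
  -- coercivity: `‖x - c'‖² ≤ D x` and `‖x - c'‖ → ∞`
  have hle : ∀ x, ‖x - c'‖ ^ 2 ≤ D x := by
    intro x
    have h0 : 0 ≤ D x := Finset.sum_nonneg fun j _ => sq_nonneg _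
    have h1 : ‖x - c'‖ ≤ Real.sqrt (D x) := by
      rw [pi_norm_le_iff_of_nonneg (Real.sqrt_nonneg _)]
      intro j
      rw [Pi.sub_apply, Real.norm_eq_abs, ← Real.sqrt_sq_eq_abs]
      exact Real.sqrt_le_sqrt (Finset.single_le_sum (fun i _ => sq_nonneg (x i - c' i))
        (Finset.mem_univ j))
    calc ‖x - c'‖ ^ 2 ≤ Real.sqrt (D x) ^ 2 := pow_le_pow_left₀ (norm_nonneg _) h1 2
      _ = D x := Real.sq_sqrt h0
  have hcoe : Tendsto D (cocompact (Fin m → ℝ)) atTop := by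
    have h1 : Tendsto (fun x : Fin m → ℝ => ‖x - c'‖) (cocompact _) atTop := by
      have h2 : Tendsto (fun x : Fin m → ℝ => ‖x‖ - ‖c'‖) (cocompact _) atTop :=
        tendsto_atTop_add_const_right _ _ tendsto_norm_cocompact_atTop
      refine tendsto_atTop_mono (fun x => ?_) h2
      have := norm_sub_norm_le x c'
      linarith [abs_le.1 (abs_norm_sub_norm_le x c')]
    have h3 : Tendsto (fun x : Fin m → ℝ => ‖x - c'‖ ^ 2) (cocompact _) atTop :=
      (tendsto_pow_atTop two_ne_zero).comp h1
    exact tendsto_atTop_mono hle h3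
  have hc : ∀ᶠ x in cocompact (Fin m → ℝ) ⊓ 𝓟 V, D x₀ ≤ D x :=
    (hcoe.eventually (eventually_ge_atTop (D x₀))).filter_mono inf_le_left
  obtain ⟨v, hv, hmin⟩ := hDc.continuousOn.exists_isMinOn' hVc hx₀ hc
  exact ⟨v, hv, fun w hw => hmin hw⟩

/-- **Points at minimal distance in the models of `T_exp`, by transfer** (Wilkie 1989, p. 397:
"(by transfer) let `(γ, γₙ₊₁)` be a point of (the "closed" set) `V(h₁, …, hₚ₊₁, F)` at minimal
distance from `(η, 0)`").  In a model `K` of `T_exp`, a nonempty zero set `V(h₁, …, h_q) ⊆ Kᵐ` of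
exponential terms with parameters from `K` contains a point minimizing the squared distance
`Σⱼ (xⱼ - cⱼ)²` to any given point `c` (coordinates given by parameter terms) over `V`.
[cite: Wilkie1989, proof of Lemma 3, p. 397] -/
theorem exists_isMinOn_sqDist (K : Language.Theory.ModelType.{0, 0, 0} realExpTheory) (a : κ → K)
    (h : Fin q → Language.orderedExpRing.Term (κ ⊕ Fin m))
    (c : Fin m → Language.orderedExpRing.Term κ)
    (hne : ∃ x : Fin m → K, ∀ r, (h r).realize (Sum.elim a x) = 0) :
    ∃ v : Fin m → K, (∀ r, (h r).realize (Sum.elim a v) = 0) ∧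
      ∀ w : Fin m → K, (∀ r, (h r).realize (Sum.elim a w) = 0) →
        ∑ j, (v j - (c j).realize a) ^ 2 ≤ ∑ j, (w j - (c j).realize a) ^ 2 := by
  have H := realize_formula_of_real K (argminFormula h c) (realize_argminFormula_real h c) a
  rw [realize_argminFormula] at H
  exact H hne

end Argmin

end RealExpModel

end Literature.ModelTheory.ExponentialFields
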